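import Summits.Ventures.PercRepro2.CaseOneLeafDelete

/-!
# Deleting an edge of weight zero: the case-1 quantities are unchanged
(blind cell PercRepro2, p1 g16; S5 §2.1 (K9) (q) — «absent edges = weight 0» in the kernel)

The cell's class theorems are stated for graphs in which the named edges *exist*, with arbitrary
weights in `[0, 1]`; on paper «an absent edge is an edge of weight `0`». This file makes the direction
that is used exact: a configuration with an edge of weight `0` open has weight `0`
(`weight_eq_zero_of_null`), so every probability of an event that is determined on `{e₀ closed}` by
the restricted configuration equals the probability of the restricted event in `G − e₀`
(`prob_restrict_null`; the open-edge configurations have weight `0`, `weight_eq_zero_of_open_null`), and for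
connection events the restriction is `conn_restrict_iff_of_closed`.
Hence `Dpd`, `Dpdo`, `Dqo`, `iiExpr`, `iExpr`, `iiExprT`, `iExprT` — at *every* marking, no leaf condition —
and the Props `ZSplitII`, `ZSplitI`, `ZSplitIIQ`, `ZSplitIQ` transfer from `G − e₀` to `G` when `p e₀ = 0`
(`iiExpr_restrict_null`, …, `zSplitII_of_restrict_null`, …). -/

namespace Summit.Ventures.PercRepro2

namespace CaseOne

section Null
variable {V : Type*} {E : Type*} [Fintype E] [DecidableEq E] {R : Type*} [CommRing R]
variable {ends : E → Sym2 V} {e₀ : E}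

omit [DecidableEq E] in
/-- A configuration with an edge of weight `0` open has weight `0`. -/
lemma weight_eq_zero_of_open_null (p : E → R) (ω : Config E) (hp0 : p e₀ = 0) (hω : ω e₀ = true) :
    weight p ω = 0 := by
  unfold weight
  exact Finset.prod_eq_zero (Finset.mem_univ e₀) (by simp [hω, hp0])

/-- **Probabilities across a null edge**: if `p e₀ = 0` and `A` is, on `{e₀ closed}`, the preimage of
`A'` under the restriction, then `P(A) = P'(A')`. -/
theorem prob_restrict_null (p : E → R) (hp0 : p e₀ = 0) (A : Set (Config E))
    (A' : Set (Config {e : E // e ≠ e₀})) (hA : ∀ ω : Config E, ω e₀ = false → (ω ∈ A ↔ restrictCfg e₀ ω ∈ A')) :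
    prob p A = prob (restrictW p e₀) A' := by
  rw [← prob_restrict]
  unfold prob
  refine Finset.sum_congr rfl fun ω _ => ?_
  by_cases hω : ω e₀ = false
  · by_cases h : ω ∈ A
    · rw [Set.indicator_of_mem h, Set.indicator_of_mem (show ω ∈ restrictCfg e₀ ⁻¹' A' from (hA ω hω).1 h)]
    · rw [Set.indicator_of_notMem h,
        Set.indicator_of_notMem (show ω ∉ restrictCfg e₀ ⁻¹' A' from fun h' => h ((hA ω hω).2 h'))]
  · have hω' : ω e₀ = true := by simpa using hω
    have hw : weight p ω = 0 := weight_eq_zero_of_open_null p ω hp0 hω'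
    simp only [Set.indicator, hw, ite_self]

omit [Fintype E] [DecidableEq E] in
/-- The restriction iff for a connection event on `{e₀ closed}`, packaged for `prob_restrict_null`. -/
lemma conn_restrict_closed {ω : Config E} (hω : ω e₀ = false) (x y : V) :
    Conn ends ω x y ↔ Conn (restrictEnds ends e₀) (restrictCfg e₀ ω) x y :=
  conn_restrict_iff_of_closed hω

variable {o a₁ a₂ a₃ b : V}

/-- `D` across a null edge. -/
theorem Dpd_restrict_null (p : E → R) (hp0 : p e₀ = 0) :
    Dpd p ends a₁ a₂ a₃ = Dpd (restrictW p e₀) (restrictEnds ends e₀) a₁ a₂ a₃ := by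
  unfold Dpd
  refine prob_restrict_null p hp0 _ _ fun ω hω => ?_
  simp only [Set.mem_inter_iff, Set.mem_compl_iff, mem_connEvent, conn_restrict_closed hω]

/-- `D_o` across a null edge. -/
theorem Dpdo_restrict_null (p : E → R) (hp0 : p e₀ = 0) :
    Dpdo p ends o a₁ a₂ a₃ = Dpdo (restrictW p e₀) (restrictEnds ends e₀) o a₁ a₂ a₃ := by
  unfold Dpdo
  refine prob_restrict_null p hp0 _ _ fun ω hω => ?_
  simp only [Set.mem_inter_iff, Set.mem_compl_iff, Set.mem_union, mem_connEvent, conn_restrict_closed hω]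

/-- `P(Q, o ∈ U)` across a null edge. -/
theorem Dqo_restrict_null (p : E → R) (hp0 : p e₀ = 0) :
    Dqo p ends o a₁ a₂ = Dqo (restrictW p e₀) (restrictEnds ends e₀) o a₁ a₂ := by
  unfold Dqo
  refine prob_restrict_null p hp0 _ _ fun ω hω => ?_
  simp only [Set.mem_inter_iff, Set.mem_compl_iff, Set.mem_union, mem_connEvent, conn_restrict_closed hω]

/-- `P(Q)` across a null edge. -/
theorem probQ_restrict_null (p : E → R) (hp0 : p e₀ = 0) :
    prob p (connEvent ends a₁ a₂)ᶜ =
      prob (restrictW p e₀) (connEvent (restrictEnds ends e₀) a₁ a₂)ᶜ := by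
  refine prob_restrict_null p hp0 _ _ fun ω hω => ?_
  simp only [Set.mem_compl_iff, mem_connEvent, conn_restrict_closed hω]

/-- The three remaining event probabilities of `iiExprT_eq` across a null edge, as one rewriting lemma
each: `P(Q, b ∈ C₂, a₃ ∈ C₁, o ∈ C₂)`. -/
theorem probQABO_restrict_null (p : E → R) (hp0 : p e₀ = 0) :
    prob p (connEvent ends a₂ b ∩ connEvent ends a₁ a₃ ∩ connEvent ends a₂ o ∩ (connEvent ends a₁ a₂)ᶜ) =
      prob (restrictW p e₀) (connEvent (restrictEnds ends e₀) a₂ b ∩ connEvent (restrictEnds ends e₀) a₁ a₃ ∩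
        connEvent (restrictEnds ends e₀) a₂ o ∩ (connEvent (restrictEnds ends e₀) a₁ a₂)ᶜ) := by
  refine prob_restrict_null p hp0 _ _ fun ω hω => ?_
  simp only [Set.mem_inter_iff, Set.mem_compl_iff, mem_connEvent, conn_restrict_closed hω]

/-- `P(Q, b ∈ C₂)` across a null edge. -/
theorem probQB_restrict_null (p : E → R) (hp0 : p e₀ = 0) :
    prob p (connEvent ends a₂ b ∩ (connEvent ends a₁ a₂)ᶜ) =
      prob (restrictW p e₀) (connEvent (restrictEnds ends e₀) a₂ b ∩ (connEvent (restrictEnds ends e₀) a₁ a₂)ᶜ) := by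
  refine prob_restrict_null p hp0 _ _ fun ω hω => ?_
  simp only [Set.mem_inter_iff, Set.mem_compl_iff, mem_connEvent, conn_restrict_closed hω]

/-- `P(Q, a₃ ∈ C₁, o ∈ C₂)` across a null edge. -/
theorem probQAO_restrict_null (p : E → R) (hp0 : p e₀ = 0) :
    prob p (connEvent ends a₁ a₃ ∩ connEvent ends a₂ o ∩ (connEvent ends a₁ a₂)ᶜ) =
      prob (restrictW p e₀) (connEvent (restrictEnds ends e₀) a₁ a₃ ∩ connEvent (restrictEnds ends e₀) a₂ o ∩
        (connEvent (restrictEnds ends e₀) a₁ a₂)ᶜ) := by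
  refine prob_restrict_null p hp0 _ _ fun ω hω => ?_
  simp only [Set.mem_inter_iff, Set.mem_compl_iff, mem_connEvent, conn_restrict_closed hω]

/-- `P(Q, b ∈ C₂, a₃ ∈ C₁)` across a null edge. -/
theorem probQAB_restrict_null (p : E → R) (hp0 : p e₀ = 0) :
    prob p (connEvent ends a₂ b ∩ connEvent ends a₁ a₃ ∩ (connEvent ends a₁ a₂)ᶜ) =
      prob (restrictW p e₀) (connEvent (restrictEnds ends e₀) a₂ b ∩ connEvent (restrictEnds ends e₀) a₁ a₃ ∩
        (connEvent (restrictEnds ends e₀) a₁ a₂)ᶜ) := by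
  refine prob_restrict_null p hp0 _ _ fun ω hω => ?_
  simp only [Set.mem_inter_iff, Set.mem_compl_iff, mem_connEvent, conn_restrict_closed hω]

/-- `P(Q, a₃ ∈ C₁)` across a null edge. -/
theorem probQA_restrict_null (p : E → R) (hp0 : p e₀ = 0) :
    prob p (connEvent ends a₁ a₃ ∩ (connEvent ends a₁ a₂)ᶜ) =
      prob (restrictW p e₀) (connEvent (restrictEnds ends e₀) a₁ a₃ ∩ (connEvent (restrictEnds ends e₀) a₁ a₂)ᶜ) := by
  refine prob_restrict_null p hp0 _ _ fun ω hω => ?_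
  simp only [Set.mem_inter_iff, Set.mem_compl_iff, mem_connEvent, conn_restrict_closed hω]

/-- `P(Q, b ∈ C₁, a₃ ∈ C₁, o ∈ C₂)` across a null edge. -/
theorem probQAB1O_restrict_null (p : E → R) (hp0 : p e₀ = 0) :
    prob p (connEvent ends a₁ b ∩ connEvent ends a₁ a₃ ∩ connEvent ends a₂ o ∩ (connEvent ends a₁ a₂)ᶜ) =
      prob (restrictW p e₀) (connEvent (restrictEnds ends e₀) a₁ b ∩ connEvent (restrictEnds ends e₀) a₁ a₃ ∩
        connEvent (restrictEnds ends e₀) a₂ o ∩ (connEvent (restrictEnds ends e₀) a₁ a₂)ᶜ) := by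
  refine prob_restrict_null p hp0 _ _ fun ω hω => ?_
  simp only [Set.mem_inter_iff, Set.mem_compl_iff, mem_connEvent, conn_restrict_closed hω]

/-- `P(Q, b ∈ C₁)` across a null edge. -/
theorem probQB1_restrict_null (p : E → R) (hp0 : p e₀ = 0) :
    prob p (connEvent ends a₁ b ∩ (connEvent ends a₁ a₂)ᶜ) =
      prob (restrictW p e₀) (connEvent (restrictEnds ends e₀) a₁ b ∩ (connEvent (restrictEnds ends e₀) a₁ a₂)ᶜ) := by
  refine prob_restrict_null p hp0 _ _ fun ω hω => ?_
  simp only [Set.mem_inter_iff, Set.mem_compl_iff, mem_connEvent, conn_restrict_closed hω]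

/-- `P(Q, b ∈ C₁, a₃ ∈ C₁)` across a null edge. -/
theorem probQAB1_restrict_null (p : E → R) (hp0 : p e₀ = 0) :
    prob p (connEvent ends a₁ b ∩ connEvent ends a₁ a₃ ∩ (connEvent ends a₁ a₂)ᶜ) =
      prob (restrictW p e₀) (connEvent (restrictEnds ends e₀) a₁ b ∩ connEvent (restrictEnds ends e₀) a₁ a₃ ∩
        (connEvent (restrictEnds ends e₀) a₁ a₂)ᶜ) := by
  refine prob_restrict_null p hp0 _ _ fun ω hω => ?_
  simp only [Set.mem_inter_iff, Set.mem_compl_iff, mem_connEvent, conn_restrict_closed hω]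

/-- **`iiExpr` across a null edge** (every marking). -/
theorem iiExpr_restrict_null (p : E → R) (hp0 : p e₀ = 0) :
    iiExpr p ends o a₁ a₂ a₃ b = iiExpr (restrictW p e₀) (restrictEnds ends e₀) o a₁ a₂ a₃ b := by
  rw [iiExpr_eq_probs, iiExpr_eq_probs, Dpd_restrict_null p hp0, Dpdo_restrict_null p hp0,
    probQ_restrict_null p hp0, probQABO_restrict_null p hp0, probQB_restrict_null p hp0,
    probQAO_restrict_null p hp0, probQAB_restrict_null p hp0, probQA_restrict_null p hp0]

/-- **`iiExprT` across a null edge** (every marking, any threshold pair). -/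
theorem iiExprT_restrict_null (p : E → R) (hp0 : p e₀ = 0) (c₀ c₁ : R) :
    iiExprT p ends o a₁ a₂ a₃ b c₀ c₁ =
      iiExprT (restrictW p e₀) (restrictEnds ends e₀) o a₁ a₂ a₃ b c₀ c₁ := by
  rw [iiExprT_eq, iiExprT_eq, probQ_restrict_null p hp0, probQABO_restrict_null p hp0,
    probQB_restrict_null p hp0, probQAO_restrict_null p hp0, probQAB_restrict_null p hp0,
    probQA_restrict_null p hp0]

/-- **`iExprT` across a null edge** (every marking, any threshold pair). -/
theorem iExprT_restrict_null (p : E → R) (hp0 : p e₀ = 0) (c₀ c₁ : R) :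
    iExprT p ends o a₁ a₂ a₃ b c₀ c₁ =
      iExprT (restrictW p e₀) (restrictEnds ends e₀) o a₁ a₂ a₃ b c₀ c₁ := by
  rw [iExprT_eq, iExprT_eq, probQ_restrict_null p hp0, probQAB1O_restrict_null p hp0,
    probQB1_restrict_null p hp0, probQAO_restrict_null p hp0, probQAB1_restrict_null p hp0,
    probQA_restrict_null p hp0]

/-- **`iExpr` across a null edge** (every marking). -/
theorem iExpr_restrict_null (p : E → R) (hp0 : p e₀ = 0) :
    iExpr p ends o a₁ a₂ a₃ b = iExpr (restrictW p e₀) (restrictEnds ends e₀) o a₁ a₂ a₃ b := by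
  rw [iExpr_eq_iExprT, iExpr_eq_iExprT, iExprT_restrict_null p hp0, Dpd_restrict_null p hp0,
    Dpdo_restrict_null p hp0]

end Null

section NullProps
variable {V : Type*} {E : Type*} [Fintype E] [DecidableEq E] {R : Type*} [CommRing R] [LinearOrder R]
variable {ends : E → Sym2 V} {o a₁ a₂ a₃ b : V} {e₀ : E}

/-- `(ii)` in `G − e₀` gives `(ii)` in `G` when `p e₀ = 0` (any marking). -/
theorem zSplitII_of_restrict_null (p : E → R) (hp0 : p e₀ = 0)
    (h : ZSplitII (restrictW p e₀) (restrictEnds ends e₀) o a₁ a₂ a₃ b) : ZSplitII p ends o a₁ a₂ a₃ b := by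
  unfold ZSplitII at h ⊢
  rw [iiExpr_restrict_null p hp0]
  exact h

/-- `(i)` in `G − e₀` gives `(i)` in `G` when `p e₀ = 0` (any marking). -/
theorem zSplitI_of_restrict_null (p : E → R) (hp0 : p e₀ = 0)
    (h : ZSplitI (restrictW p e₀) (restrictEnds ends e₀) o a₁ a₂ a₃ b) : ZSplitI p ends o a₁ a₂ a₃ b := by
  unfold ZSplitI at h ⊢
  rw [iExpr_restrict_null p hp0]
  exact h

/-- `(ii-Q)` in `G − e₀` gives `(ii-Q)` in `G` when `p e₀ = 0` (any marking). -/
theorem zSplitIIQ_of_restrict_null (p : E → R) (hp0 : p e₀ = 0)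
    (h : ZSplitIIQ (restrictW p e₀) (restrictEnds ends e₀) o a₁ a₂ a₃ b) :
    ZSplitIIQ p ends o a₁ a₂ a₃ b := by
  unfold ZSplitIIQ at h ⊢
  rw [iiExprT_restrict_null p hp0, Dqo_restrict_null p hp0, probQ_restrict_null p hp0]
  exact h

/-- `(i-Q)` in `G − e₀` gives `(i-Q)` in `G` when `p e₀ = 0` (any marking). -/
theorem zSplitIQ_of_restrict_null (p : E → R) (hp0 : p e₀ = 0)
    (h : ZSplitIQ (restrictW p e₀) (restrictEnds ends e₀) o a₁ a₂ a₃ b) :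
    ZSplitIQ p ends o a₁ a₂ a₃ b := by
  unfold ZSplitIQ at h ⊢
  rw [iExprT_restrict_null p hp0, Dqo_restrict_null p hp0, probQ_restrict_null p hp0]
  exact h

end NullProps

end CaseOne

end Summit.Ventures.PercRepro2
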